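import Mathlib
import HarnessLib

/-!
# Venture HSemireg — THEOREM L′ as an exact identity and the `|S| = 4` dictionary of the flat sliver (W5 seat w5-n6-2 gen 19)

Bookkeeping of the computation cell `pub-hsemireg`, group W5 (notes `widen/W5/FLATTF-w5n62g17.md` §8,
`widen/W5/SLIVER-w5n62g18.md` §0 and §2 REMARK (b); this leg `widen/W5/KERNEL-M-w5n62g19.md` §5, deposit
`widen/W5/n6code2/v22/dictionary/`). Companion of `FlatMomentIdentity.lean` (same seat, same method; the two
files are independent and import nothing of the tree; the Fubini steps are local `have`s here, the
tree-level `sum4_*` lemmas being those of `FlatMomentIdentity`).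

SETTING (as in `FlatMomentIdentity`). Four finite level types `A, B, C, D` with `t` levels each, six
matrices `xAB, …, xCD` over a commutative ring `R` with every row and column sum `d`; for `0 ∕ 1`
entries (a flat `(d,t)` four-coordinate design) the sums over transversals `(a,b,c,e)` below are: `I` =
INDEPENDENT transversals (no torus), `K₄` = all six tori, `ΣpM` = exactly a perfect matching (`= 2Ω` of
THEOREM L ∕ L′), `T_XYZ` = transversal triangles of the triple `XYZ`.

* `momentI_monomials` — pointwise: `2·[no torus] + [all six] − [exactly a perfect matching]` expands in
  indicator monomials as `2 − 2Σedges + 2Σ2-paths + Σmatchings − 2Σtriangles − 2Σstars − Σ3-paths +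
  Σpaws`; the three 4-cycle, six five-torus and the six-torus monomials cancel (`ring`).
* `momentI` — **THEOREM L′ in identity form** (SLIVER §2 (b): THEOREM L′ of FLATTF §8 — there
  `ΣN(C₄) = 6td³ − (3∕2)t²d² − (3∕2)d·T_tot + ΣF₅ − (3∕2)N(K₄) + Ω`, `Ω` counted by complement boxes,
  kernel leg `FlatFourCoordinateBoxes` in inequality form — rewritten with `2Ω = ΣpM` as the
  inclusion–exclusion identity for independent transversals):
  `2·I + K₄ = ΣpM + 2t⁴ − 12t³d + 27t²d² − 20td³ + (3d − 2t)·(T_ABC + T_ABD + T_ACD + T_BCD)`,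
  for ARBITRARY matrices with constant line sums (multilinear; Fubini + line sums: edge = `t³d`,
  2-path = matching = `t²d²`, 3-path = star = `td³`, triangle = `t·T`, paw = `d·T`).
* `phi_law_of_independent_count`, `two_mul_independent_count_of_phi_law` — **the DICTIONARY of
  SLIVER §0**: given the summed `|S| ≤ 3` class equations `ΣT = 4 t d σ`, the `|S| = 4` class equation
  in the printed form of N7-FEASIBILITY §3.8 (a) ∕ §3.1, «the number of independent transversals is
  `A₄(t, m, s) = t⁴ − m (6t² + 4st + s² − m)` with `m = t d`, `s = σ − 3d`», IMPLIES the law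
  `K₄ − ΣpM = 2 t d σ² + t d² (t − 2d)` used by COROLLARY L′ ∕ COROLLARY M (`FlatMomentIdentity`,
  `FlatMomentWindow`), and conversely the law gives `2·I = 2·A₄` (cancel the `2` in characteristic `≠ 2`).
* `compl_line_sum`, `triangle_two_compl`, `klein_pointwise` — the `t = 2d` KLEIN DUALITY of SLIVER §3:
  complementing the four tori outside a perfect matching keeps line sums `d` (at `t = 2d`) and the four
  triangle counts (`Σ xAB(1 − xAC)(1 − xBC) = T_ABC + t d (t − 2d)`), swaps `[all six]` with `[exactly M]`,
  and `Φ(D) + Φ(D^M) = −2 (p_{M′} + p_{M″})` pointwise.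

HONEST FRAMING: finite sums over four finite types and ring arithmetic only. That a K-secant pure
coordinate skeleton with flat margins satisfies `T_XYZ = t d σ` and `I = A₄` is N7-FEASIBILITY §3.8 (the
notes), not this file. Nothing in this file says that HC, HC_CM or HC_AV holds; no door ∕ tier ∕ report
sentence of the cell is a consequence of this file alone.
-/

namespace Summit.Ventures.HSemireg
namespace FlatIndependentTransversals
open Finset

section Pointwise
variable {R : Type*} [CommRing R]

/-- **THEOREM L′, pointwise.** For one transversal with torus indicators `x1 … x6` (order `AB, AC, AD,
BC, BD, CD`; arbitrary ring elements), `2·[no torus] + [all six tori] − [exactly a perfect matching]`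
expands in monomials as `2 − 2Σedges + 2Σ2-paths + Σmatchings − 2Σtriangles − 2Σstars − Σ3-paths +
Σpaws` (each monomial in the factor order in which `momentI` sums it out). -/
theorem momentI_monomials (x1 x2 x3 x4 x5 x6 : R) :
    2 * ((1 - x1) * (1 - x2) * (1 - x3) * (1 - x4) * (1 - x5) * (1 - x6))
      + x1 * x2 * x3 * x4 * x5 * x6
      - (x1 * x6 * (1 - x2) * (1 - x3) * (1 - x4) * (1 - x5)
        + x2 * x5 * (1 - x1) * (1 - x3) * (1 - x4) * (1 - x6)
        + x3 * x4 * (1 - x1) * (1 - x2) * (1 - x5) * (1 - x6))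
    = 2 - 2 • (x1 + x2 + x3 + x4 + x5 + x6)
      + 2 • (x1 * x2 + x1 * x3 + x2 * x3 + x1 * x4 + x1 * x5 + x4 * x5
        + x2 * x4 + x2 * x6 + x4 * x6 + x3 * x5 + x3 * x6 + x5 * x6)
      + (x1 * x6 + x2 * x5 + x3 * x4)
      - 2 • (x1 * x2 * x4 + x1 * x3 * x5 + x2 * x3 * x6 + x4 * x5 * x6)
      - 2 • (x1 * x2 * x3 + x1 * x4 * x5 + x4 * x6 * x2 + x3 * x5 * x6)
      - (x1 * x4 * x6 + x1 * x5 * x6 + x2 * x4 * x5 + x2 * x6 * x5 + x3 * x5 * x4 + x3 * x6 * x4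
        + x1 * x2 * x6 + x1 * x3 * x6 + x2 * x1 * x5 + x2 * x3 * x5 + x3 * x1 * x4 + x3 * x2 * x4)
      + (x1 * x2 * x4 * x3 + x1 * x2 * x4 * x5 + x1 * x2 * x4 * x6
        + x1 * x3 * x5 * x2 + x1 * x3 * x5 * x4 + x1 * x3 * x5 * x6
        + x2 * x3 * x6 * x1 + x2 * x3 * x6 * x4 + x2 * x3 * x6 * x5
        + x4 * x5 * x6 * x1 + x4 * x5 * x6 * x2 + x4 * x5 * x6 * x3) := by
  simp only [nsmul_eq_mul, Nat.cast_ofNat]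
  ring

end Pointwise
section Design
variable {R : Type*} [CommRing R]
variable {A B C D : Type*} [Fintype A] [Fintype B] [Fintype C] [Fintype D]
variable (t d : R) (xAB : A → B → R) (xAC : A → C → R) (xAD : A → D → R)
  (xBC : B → C → R) (xBD : B → D → R) (xCD : C → D → R)

/-- **THEOREM L′ as an identity for independent transversals** (SLIVER-w5n62g18 §2 REMARK (b)'s
reading of THEOREM L′ of FLATTF-w5n62g17 §8, with `ΣpM` for `2Ω`; the g17 kernel leg has the box-count
inequality). Four finite level types with `t` levels each, six matrices with all row and column sums `d`. With `I` (no torus), `K₄` (all six tori), `ΣpM` (exactly a perfect matching)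
summed over the transversals and the four triangle counts `T_XYZ`:
`2·I + K₄ = ΣpM + 2t⁴ − 12t³d + 27t²d² − 20td³ + (3d − 2t)·(T_ABC + T_ABD + T_ACD + T_BCD)`. -/
theorem momentI (hA : (Fintype.card A : R) = t) (hB : (Fintype.card B : R) = t)
    (hC : (Fintype.card C : R) = t) (hD : (Fintype.card D : R) = t)
    (rAB : ∀ a, ∑ b, xAB a b = d) (cAB : ∀ b, ∑ a, xAB a b = d)
    (rAC : ∀ a, ∑ c, xAC a c = d) (cAC : ∀ c, ∑ a, xAC a c = d)
    (rAD : ∀ a, ∑ e, xAD a e = d) (cAD : ∀ e, ∑ a, xAD a e = d)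
    (rBC : ∀ b, ∑ c, xBC b c = d) (cBC : ∀ c, ∑ b, xBC b c = d)
    (rBD : ∀ b, ∑ e, xBD b e = d) (cBD : ∀ e, ∑ b, xBD b e = d)
    (rCD : ∀ c, ∑ e, xCD c e = d) (cCD : ∀ e, ∑ c, xCD c e = d) :
    2 * (∑ a, ∑ b, ∑ c, ∑ e, (1 - xAB a b) * (1 - xAC a c) * (1 - xAD a e) * (1 - xBC b c)
          * (1 - xBD b e) * (1 - xCD c e))
      + (∑ a, ∑ b, ∑ c, ∑ e, xAB a b * xAC a c * xAD a e * xBC b c * xBD b e * xCD c e)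
    = (∑ a, ∑ b, ∑ c, ∑ e,
          (xAB a b * xCD c e * (1 - xAC a c) * (1 - xAD a e) * (1 - xBC b c) * (1 - xBD b e)
          + xAC a c * xBD b e * (1 - xAB a b) * (1 - xAD a e) * (1 - xBC b c) * (1 - xCD c e)
          + xAD a e * xBC b c * (1 - xAB a b) * (1 - xAC a c) * (1 - xBD b e) * (1 - xCD c e)))
      + 2 * t ^ 4 - 12 * t ^ 3 * d + 27 * t ^ 2 * d ^ 2 - 20 * t * d ^ 3
      + (3 * d - 2 * t) * ((∑ a, ∑ b, ∑ c, xAB a b * xAC a c * xBC b c)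
          + (∑ a, ∑ b, ∑ e, xAB a b * xAD a e * xBD b e)
          + (∑ a, ∑ c, ∑ e, xAC a c * xAD a e * xCD c e)
          + (∑ b, ∑ c, ∑ e, xBC b c * xBD b e * xCD c e)) := by
  -- Fubini inside this proof (kept local: the tree-level `sum4_*` lemmas live in `FlatMomentIdentity`)
  have sum4_swap34 : ∀ f : A → B → C → D → R,
      ∑ a, ∑ b, ∑ c, ∑ e, f a b c e = ∑ a, ∑ b, ∑ e, ∑ c, f a b c e :=
    fun f => Finset.sum_congr rfl fun _ _ => Finset.sum_congr rfl fun _ _ => Finset.sum_comm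
  have sum4_in2 : ∀ f : A → B → C → D → R,
      ∑ a, ∑ b, ∑ c, ∑ e, f a b c e = ∑ a, ∑ c, ∑ e, ∑ b, f a b c e :=
    fun f => Finset.sum_congr rfl fun _ _ =>
      Finset.sum_comm.trans (Finset.sum_congr rfl fun _ _ => Finset.sum_comm)
  have sum4_in1 : ∀ f : A → B → C → D → R,
      ∑ a, ∑ b, ∑ c, ∑ e, f a b c e = ∑ b, ∑ c, ∑ e, ∑ a, f a b c e :=
    fun f => Finset.sum_comm.trans (Finset.sum_congr rfl fun _ _ =>
      Finset.sum_comm.trans (Finset.sum_congr rfl fun _ _ => Finset.sum_comm))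
  have sum4_e2 : ∀ f : A → B → C → D → R,
      ∑ a, ∑ b, ∑ c, ∑ e, f a b c e = ∑ a, ∑ e, ∑ b, ∑ c, f a b c e :=
    fun f => Finset.sum_congr rfl fun _ _ =>
      (Finset.sum_congr rfl fun _ _ => Finset.sum_comm).trans Finset.sum_comm
  have hsum : ∑ a, ∑ b, ∑ c, ∑ e,
      (2 * ((1 - xAB a b) * (1 - xAC a c) * (1 - xAD a e) * (1 - xBC b c) * (1 - xBD b e)
          * (1 - xCD c e))
        + xAB a b * xAC a c * xAD a e * xBC b c * xBD b e * xCD c e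
        - (xAB a b * xCD c e * (1 - xAC a c) * (1 - xAD a e) * (1 - xBC b c) * (1 - xBD b e)
          + xAC a c * xBD b e * (1 - xAB a b) * (1 - xAD a e) * (1 - xBC b c) * (1 - xCD c e)
          + xAD a e * xBC b c * (1 - xAB a b) * (1 - xAC a c) * (1 - xBD b e) * (1 - xCD c e)))
      = 2 * t ^ 4 - 12 * t ^ 3 * d + 27 * t ^ 2 * d ^ 2 - 20 * t * d ^ 3
        + (3 * d - 2 * t) * ((∑ a, ∑ b, ∑ c, xAB a b * xAC a c * xBC b c)
          + (∑ a, ∑ b, ∑ e, xAB a b * xAD a e * xBD b e)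
          + (∑ a, ∑ c, ∑ e, xAC a c * xAD a e * xCD c e)
          + (∑ b, ∑ c, ∑ e, xBC b c * xBD b e * xCD c e)) := by
    simp_rw [momentI_monomials]
    simp only [sum_add_distrib, sum_sub_distrib, ← smul_sum]
    -- Fubini: bring a coordinate met by at most one torus innermost where the last one carries two
    rw [sum4_in2 fun a b c _ => xAC a c * xBC b c, sum4_in2 fun a b _ e => xAD a e * xBD b e,
      sum4_swap34 fun a _ c e => xAD a e * xCD c e, sum4_swap34 fun _ b c e => xBD b e * xCD c e,
      sum4_in1 fun a b c e => xBC b c * xCD c e * xAC a c,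
      sum4_e2 fun a b c e => xAD a e * xBD b e * xCD c e,
      sum4_swap34 fun a b c e => xAB a b * xBD b e * xCD c e,
      sum4_in1 fun a b c e => xAC a c * xBC b c * xBD b e,
      sum4_in2 fun a b c e => xAC a c * xCD c e * xBD b e,
      sum4_in1 fun a b c e => xAD a e * xBD b e * xBC b c,
      sum4_in1 fun a b c e => xAD a e * xCD c e * xBC b c,
      sum4_swap34 fun a b c e => xAB a b * xAD a e * xCD c e,
      sum4_in2 fun a b c e => xAC a c * xAD a e * xBD b e,
      sum4_in2 fun a b c e => xAD a e * xAC a c * xBC b c,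
      sum4_swap34 fun a b c e => xAB a b * xAD a e * xBD b e * xCD c e,
      sum4_in2 fun a b c e => xAC a c * xAD a e * xCD c e * xBC b c,
      sum4_in2 fun a b c e => xAC a c * xAD a e * xCD c e * xBD b e,
      sum4_in1 fun a b c e => xBC b c * xBD b e * xCD c e * xAB a b,
      sum4_in1 fun a b c e => xBC b c * xBD b e * xCD c e * xAC a c,
      sum4_in1 fun a b c e => xBC b c * xBD b e * xCD c e * xAD a e]
    simp only [sum_const, card_univ, nsmul_eq_mul, hA, hB, hC, hD, ← mul_sum, ← sum_mul,
      rAB, cAB, rAC, cAC, rAD, cAD, rBC, cBC, rBD, cBD, rCD, cCD, Nat.cast_ofNat]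
    ring
  simp only [sum_add_distrib, sum_sub_distrib, ← mul_sum] at hsum ⊢
  linear_combination hsum

/-- **The `|S| = 4` dictionary, printed form ⇒ law** (SLIVER-w5n62g18 §0). Same data and a parameter `σ`.
If the four triangle counts sum to `4 t d σ` (the `|S| ≤ 3` class equations `T_XYZ = t d σ` summed) and
the number of independent transversals is `A₄(t, m, s) = t⁴ − m (6t² + 4st + s² − m)` with `m = t d`,
`s = σ − 3d` (the `|S| = 4` class equation of N7-FEASIBILITY §3.8 (a) as printed), then
`K₄ − ΣpM = 2 t d σ² + t d² (t − 2d)` — the law used by COROLLARY L′ and COROLLARY M. -/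
theorem phi_law_of_independent_count (σ : R)
    (hA : (Fintype.card A : R) = t) (hB : (Fintype.card B : R) = t)
    (hC : (Fintype.card C : R) = t) (hD : (Fintype.card D : R) = t)
    (rAB : ∀ a, ∑ b, xAB a b = d) (cAB : ∀ b, ∑ a, xAB a b = d)
    (rAC : ∀ a, ∑ c, xAC a c = d) (cAC : ∀ c, ∑ a, xAC a c = d)
    (rAD : ∀ a, ∑ e, xAD a e = d) (cAD : ∀ e, ∑ a, xAD a e = d)
    (rBC : ∀ b, ∑ c, xBC b c = d) (cBC : ∀ c, ∑ b, xBC b c = d)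
    (rBD : ∀ b, ∑ e, xBD b e = d) (cBD : ∀ e, ∑ b, xBD b e = d)
    (rCD : ∀ c, ∑ e, xCD c e = d) (cCD : ∀ e, ∑ c, xCD c e = d)
    (hT : (∑ a, ∑ b, ∑ c, xAB a b * xAC a c * xBC b c)
          + (∑ a, ∑ b, ∑ e, xAB a b * xAD a e * xBD b e)
          + (∑ a, ∑ c, ∑ e, xAC a c * xAD a e * xCD c e)
          + (∑ b, ∑ c, ∑ e, xBC b c * xBD b e * xCD c e) = 4 * t * d * σ)
    (hI : (∑ a, ∑ b, ∑ c, ∑ e, (1 - xAB a b) * (1 - xAC a c) * (1 - xAD a e) * (1 - xBC b c)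
          * (1 - xBD b e) * (1 - xCD c e))
        = t ^ 4 - t * d * (6 * t ^ 2 + 4 * (σ - 3 * d) * t + (σ - 3 * d) ^ 2 - t * d)) :
    (∑ a, ∑ b, ∑ c, ∑ e, xAB a b * xAC a c * xAD a e * xBC b c * xBD b e * xCD c e)
      - (∑ a, ∑ b, ∑ c, ∑ e,
          (xAB a b * xCD c e * (1 - xAC a c) * (1 - xAD a e) * (1 - xBC b c) * (1 - xBD b e)
          + xAC a c * xBD b e * (1 - xAB a b) * (1 - xAD a e) * (1 - xBC b c) * (1 - xCD c e)
          + xAD a e * xBC b c * (1 - xAB a b) * (1 - xAC a c) * (1 - xBD b e) * (1 - xCD c e)))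
      = 2 * t * d * σ ^ 2 + t * d ^ 2 * (t - 2 * d) := by
  have h := momentI t d xAB xAC xAD xBC xBD xCD hA hB hC hD rAB cAB rAC cAC rAD cAD rBC cBC rBD
    cBD rCD cCD
  linear_combination h - 2 * hI + (3 * d - 2 * t) * hT

/-- **The `|S| = 4` dictionary, law ⇒ printed form** (converse of `phi_law_of_independent_count`):
the law `K₄ − ΣpM = 2 t d σ² + t d² (t − 2d)` together with `ΣT = 4 t d σ` gives `2·I = 2·A₄(t, m, s)`
(so `I = A₄` wherever `2` is cancellable, e.g. over `ℤ` or `ℚ`). -/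
theorem two_mul_independent_count_of_phi_law (σ : R)
    (hA : (Fintype.card A : R) = t) (hB : (Fintype.card B : R) = t)
    (hC : (Fintype.card C : R) = t) (hD : (Fintype.card D : R) = t)
    (rAB : ∀ a, ∑ b, xAB a b = d) (cAB : ∀ b, ∑ a, xAB a b = d)
    (rAC : ∀ a, ∑ c, xAC a c = d) (cAC : ∀ c, ∑ a, xAC a c = d)
    (rAD : ∀ a, ∑ e, xAD a e = d) (cAD : ∀ e, ∑ a, xAD a e = d)
    (rBC : ∀ b, ∑ c, xBC b c = d) (cBC : ∀ c, ∑ b, xBC b c = d)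
    (rBD : ∀ b, ∑ e, xBD b e = d) (cBD : ∀ e, ∑ b, xBD b e = d)
    (rCD : ∀ c, ∑ e, xCD c e = d) (cCD : ∀ e, ∑ c, xCD c e = d)
    (hT : (∑ a, ∑ b, ∑ c, xAB a b * xAC a c * xBC b c)
          + (∑ a, ∑ b, ∑ e, xAB a b * xAD a e * xBD b e)
          + (∑ a, ∑ c, ∑ e, xAC a c * xAD a e * xCD c e)
          + (∑ b, ∑ c, ∑ e, xBC b c * xBD b e * xCD c e) = 4 * t * d * σ)
    (hlaw : (∑ a, ∑ b, ∑ c, ∑ e, xAB a b * xAC a c * xAD a e * xBC b c * xBD b e * xCD c e)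
      - (∑ a, ∑ b, ∑ c, ∑ e,
          (xAB a b * xCD c e * (1 - xAC a c) * (1 - xAD a e) * (1 - xBC b c) * (1 - xBD b e)
          + xAC a c * xBD b e * (1 - xAB a b) * (1 - xAD a e) * (1 - xBC b c) * (1 - xCD c e)
          + xAD a e * xBC b c * (1 - xAB a b) * (1 - xAC a c) * (1 - xBD b e) * (1 - xCD c e)))
      = 2 * t * d * σ ^ 2 + t * d ^ 2 * (t - 2 * d)) :
    2 * (∑ a, ∑ b, ∑ c, ∑ e, (1 - xAB a b) * (1 - xAC a c) * (1 - xAD a e) * (1 - xBC b c)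
          * (1 - xBD b e) * (1 - xCD c e))
      = 2 * (t ^ 4 - t * d * (6 * t ^ 2 + 4 * (σ - 3 * d) * t + (σ - 3 * d) ^ 2 - t * d)) := by
  have h := momentI t d xAB xAC xAD xBC xBD xCD hA hB hC hD rAB cAB rAC cAC rAD cAD rBC cBC rBD
    cBD rCD cCD
  linear_combination h - hlaw + (3 * d - 2 * t) * hT

end Design

section Klein
/-! ### The `t = 2d` Klein duality (SLIVER-w5n62g18 §3 (a)(b)): complement the four tori outside a
perfect matching -/
variable {R : Type*} [CommRing R]
variable {A B C : Type*} [Fintype A] [Fintype B] [Fintype C]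

omit [Fintype A] in
/-- At `t = 2d` the complement `1 − x` of a torus matrix with line sums `d` again has line sums `d`
(in general `Σ_b (1 − x a b) = t − d`). -/
theorem compl_line_sum (t d : R) (x : A → B → R) (hB : (Fintype.card B : R) = t)
    (ht : t = 2 * d) (r : ∀ a, ∑ b, x a b = d) (a : A) : ∑ b, (1 - x a b) = d := by
  simp only [sum_sub_distrib, r a, sum_const, card_univ, nsmul_eq_mul, mul_one, hB, ht]; ring

/-- Triangle count of a coordinate triple after complementing the two tori through its third
coordinate: `Σ xAB (1 − xAC)(1 − xBC) = T_ABC + t d (t − 2d)` for matrices with line sums `d` on `t`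
levels — so at `t = 2d` the dual design `D^M` has the SAME four triangle counts (SLIVER §3 (a): «the
apexes in `D^M` are the common NON-neighbours»). -/
theorem triangle_two_compl (t d : R) (xAB : A → B → R) (xAC : A → C → R) (xBC : B → C → R)
    (hA : (Fintype.card A : R) = t) (hC : (Fintype.card C : R) = t) (rAB : ∀ a, ∑ b, xAB a b = d)
    (rAC : ∀ a, ∑ c, xAC a c = d) (rBC : ∀ b, ∑ c, xBC b c = d) :
    ∑ a, ∑ b, ∑ c, xAB a b * (1 - xAC a c) * (1 - xBC b c)
      = (∑ a, ∑ b, ∑ c, xAB a b * xAC a c * xBC b c) + t * d * (t - 2 * d) := by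
  have hpt : ∀ a b c, xAB a b * (1 - xAC a c) * (1 - xBC b c)
      = xAB a b - xAB a b * xAC a c - xAB a b * xBC b c + xAB a b * xAC a c * xBC b c := by
    intros; ring
  simp_rw [hpt]
  simp only [sum_add_distrib, sum_sub_distrib]
  simp only [sum_const, card_univ, nsmul_eq_mul, hA, hC, ← mul_sum, ← sum_mul, rAB, rAC, rBC]
  ring

/-- **Klein duality, pointwise** (SLIVER §3 (b)). With `Φ`-summand `φ(x) = [all six] − [exactly a
perfect matching]` and `x^M` the transversal with the four tori outside the matching `M = {AB, CD}`
complemented (`x2, x3, x4, x5 ↦ 1 − xᵢ`): `φ(x) + φ(x^M) = −2 ([exactly {AC, BD}] + [exactly {AD, BC}])(x)`;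
summed over the transversals of a flat `(d, 2d)` design, `Φ(D) + Φ(D^M) = −2 (p_{M′} + p_{M″}) ≤ 0`, so
at most one member of a Klein orbit satisfies the `|S| = 4` law with `σ > 0`. -/
theorem klein_pointwise (x1 x2 x3 x4 x5 x6 : R) :
    (x1 * x2 * x3 * x4 * x5 * x6
      - (x1 * x6 * (1 - x2) * (1 - x3) * (1 - x4) * (1 - x5)
        + x2 * x5 * (1 - x1) * (1 - x3) * (1 - x4) * (1 - x6)
        + x3 * x4 * (1 - x1) * (1 - x2) * (1 - x5) * (1 - x6)))
    + (x1 * (1 - x2) * (1 - x3) * (1 - x4) * (1 - x5) * x6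
      - (x1 * x6 * (1 - (1 - x2)) * (1 - (1 - x3)) * (1 - (1 - x4)) * (1 - (1 - x5))
        + (1 - x2) * (1 - x5) * (1 - x1) * (1 - (1 - x3)) * (1 - (1 - x4)) * (1 - x6)
        + (1 - x3) * (1 - x4) * (1 - x1) * (1 - (1 - x2)) * (1 - (1 - x5)) * (1 - x6)))
    = -2 * (x2 * x5 * (1 - x1) * (1 - x3) * (1 - x4) * (1 - x6)
        + x3 * x4 * (1 - x1) * (1 - x2) * (1 - x5) * (1 - x6)) := by
  ring

end Klein
end FlatIndependentTransversals
end Summit.Ventures.HSemireg
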